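import Summits.HubbardSuperconductivity.HubbardSuperconductivity.Theorems.AnisotropyChordTransferExclusionGap

/-!
# Route `AnisotropyChord` / H0 rotor rung, route (1): THE HEISENBERG-POINT SECTOR GAP ON AN ARBITRARY CONNECTED GRAPH
# (Caputo–Liggett–Richthammer for the spin-½ XXZ ferromagnet at `Δ = 1`, Temple form)

`FerroSectorGapCLR` (tree theorem `ferroSectorGapCLR_holds`) is the `L × L`-torus instance of a statement that holds on every
finite connected graph `G`: at `Δ = 1` the Hamiltonian `H(1) = xxzHamiltonian 1 G (−1) 1 = −Σ_{edges}[½(S⁺S⁻ + h.c.) + SᶻSᶻ]`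
restricted to a magnetisation sector is `−D/8 + A` with `A = ½ Σ_{edges}(1 − T_xy)` the generator of the symmetric exclusion
process (tree `xxz_mulVec_real_apply`, `inner_fmOp_eq`), so by the stirring projection of the tree's CLR theorem
(`exclusion_poincare_of_rw_gap`) every one-particle Poincaré constant `t` of `G` (rate `½` per edge) is a Temple-form gap of
every sector:

* `mem_spinZSector_of_zerosCard` — a real amplitude supported on `{zerosCard = |V|/2 + M}` lies in the sector `Sᶻ_tot = M`
  (general vertex type; the torus version is `Tower.mem_spinZSector_of_support`);
* `sectorGround_one_const` — a unit real sector amplitude `a` with `H(1) a = E(M) a` has `⟨a, A a⟩ = 0`, `E(M) = −D/8`, and is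
  constant on every particle-number sector (`G` connected);
* **`ferroSectorGap_graph`** — for such `a` and every unit real amplitude `φ` of the sector,
  `t (1 − ⟨a, φ⟩²) ≤ Re⟨φ, H(1) φ⟩ − E(M)`.

This is the input «CLR on the once-punctured torus» (and on any other host graph) of the theory seat's three-magnon programme
(memo ROTOR-THEORY-19 §254, PROP R2), up to the one-particle Poincaré constant of that graph.  Prover seat `hubbard-h0-rotor-p1`
g20; helper for the S-bridge dossier of stmt-HubbardSuperconductivity-19089.  No definition is introduced.
-/

set_option linter.dupNamespace false
set_option autoImplicit false

noncomputable section

open Finset Matrix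
open Literature.MathematicalPhysics.QuantumLattice Literature.Probability.LatticeModels
open Summit.HubbardSuperconductivity.HubbardSuperconductivity.Theorems.AnisotropyChord.Tower

namespace Summit.HubbardSuperconductivity.HubbardSuperconductivity.Theorems.AnisotropyChord.Transfer

section General

variable {V : Type} [Fintype V] [DecidableEq V]

/-- A real amplitude supported on `zerosCard = |V|/2 + M` lies (read in `ℂ`) in the sector `Sᶻ_tot = M` (general vertex
type). [folklore] -/
theorem mem_spinZSector_of_zerosCard (M : ℝ) (b : (V → Fin 2) → ℝ)
    (hb : ∀ σ, b σ ≠ 0 → zerosCard σ = (Fintype.card V : ℝ) / 2 + M) :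
    (fun τ => (b τ : ℂ)) ∈ spinZSector (Λ := V) 1 M := by
  refine (LiebMattis.mem_spinZSector_iff (Λ := V) 1 M _).2 fun σ hσ => ?_
  have hσ' : b σ ≠ 0 := by simpa using hσ
  have hz := hb σ hσ'
  have hones : (∑ x : V, ((σ x : ℕ) : ℝ)) = (Fintype.card V : ℝ) - zerosCard σ := by
    have h1 : ∀ x : V, ((σ x : ℕ) : ℝ) = 1 - (if σ x = 0 then (1:ℝ) else 0) := by
      intro x
      rcases Fin.exists_fin_two.mp ⟨σ x, rfl⟩ with hx | hx <;> simp [hx]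
    simp_rw [h1]
    rw [Finset.sum_sub_distrib, Finset.sum_const, Finset.card_univ, nsmul_eq_mul, mul_one]
    unfold zerosCard; rw [← Finset.sum_filter]; simp
  have hre : (∑ x : V, ((1 : ℝ) / 2 - (σ x : ℕ))) = M := by
    rw [Finset.sum_sub_distrib, Finset.sum_const, Finset.card_univ, nsmul_eq_mul, hones, hz]; ring
  have := congrArg (fun r : ℝ => (r : ℂ)) hre
  push_cast at this ⊢
  exact this

variable (G : SimpleGraph V) [DecidableRel G.Adj]

/-- **The `Δ = 1` dictionary on a connected graph:** a unit real amplitude `a` of the sector `Sᶻ_tot = M` with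
`H(1) a = E(M) a` has `⟨a, A a⟩ = 0`, `E(M) + D/8 = 0`, and is constant on every particle-number sector. [folklore] -/
theorem sectorGround_one_const (hconn : G.Connected) (M : ℝ) (a : (V → Fin 2) → ℝ)
    (hasupp : ∀ σ, a σ ≠ 0 → zerosCard σ = (Fintype.card V : ℝ) / 2 + M) (haunit : ∑ σ, a σ ^ 2 = 1)
    (haeig : (xxzHamiltonian 1 G (-1) 1 : Op V 2) *ᵥ (fun σ => (a σ : ℂ))
        = ((lowestEnergyInSector 1 (xxzHamiltonian 1 G (-1) 1) M : ℝ) : ℂ) • (fun σ => (a σ : ℂ))) :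
    ∑ σ, a σ * fmOp G a σ = 0 ∧
      lowestEnergyInSector 1 (xxzHamiltonian 1 G (-1) 1) M
        + (1/8 : ℝ) * ∑ x, ∑ y, (if G.Adj x y then (1:ℝ) else 0) = 0 ∧
      ∀ σ σ' : V → Fin 2, zerosCard σ = zerosCard σ' → a σ = a σ' := by
  -- pointwise eigen-equation in amplitude form
  have hpt : ∀ σ, fmOp G a σ = (lowestEnergyInSector 1 (xxzHamiltonian 1 G (-1) 1) M
      + (1/8 : ℝ) * ∑ x, ∑ y, (if G.Adj x y then (1:ℝ) else 0)) * a σ := by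
    intro σ
    have h := congrFun haeig σ
    rw [xxz_mulVec_real_apply, Pi.smul_apply, smul_eq_mul] at h
    have h' : (fmOp G a σ + (1 - 1) * (isingW G σ * a σ)
        - (1/8 : ℝ) * (∑ x, ∑ y, if G.Adj x y then (1:ℝ) else 0) * a σ : ℝ)
        = lowestEnergyInSector 1 (xxzHamiltonian 1 G (-1) 1) M * a σ := by
      exact_mod_cast h
    linarith
  set E : ℝ := lowestEnergyInSector 1 (xxzHamiltonian 1 G (-1) 1) M with hEdef
  set D8 : ℝ := (1/8 : ℝ) * ∑ x, ∑ y, (if G.Adj x y then (1:ℝ) else 0) with hD8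
  have h1 : ∑ σ, a σ * fmOp G a σ = E + D8 := by
    calc ∑ σ, a σ * fmOp G a σ = ∑ σ, (E + D8) * a σ ^ 2 :=
          Finset.sum_congr rfl fun σ _ => by rw [hpt σ]; ring
      _ = E + D8 := by rw [← Finset.mul_sum, haunit, mul_one]
  -- Rayleigh–Ritz with the uniform sector amplitude
  set n : ℝ := (Fintype.card V : ℝ) / 2 + M with hn
  set b : (V → Fin 2) → ℝ := fun σ => if zerosCard σ = n then 1 else 0 with hb
  have hbsupp : ∀ σ, b σ ≠ 0 → zerosCard σ = n := by
    intro σ h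
    by_contra hne
    exact h (by simp only [hb, hne, if_false])
  have hbmem := mem_spinZSector_of_zerosCard M b hbsupp
  have hray := minEnergyOn_mul_le_rayleigh_of_mem (xxzHamiltonian_isHermitian 1 G (-1) 1)
    (spinZSector (Λ := V) 1 M) hbmem
  rw [star_dotProduct_real, star_dotProduct_xxz_real, Complex.ofReal_re, Complex.ofReal_re] at hray
  have hfm : fmOp G b = fun _ => 0 := fmOp_sectorFun G (fun r => if r = n then (1:ℝ) else 0)
  have hR : ∑ σ, b σ * (fmOp G b σ + (1 - 1) * (isingW G σ * b σ)) = 0 := by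
    refine Finset.sum_eq_zero fun σ _ => ?_
    rw [hfm]
    ring
  rw [hR] at hray
  -- `a` has a support point, in the sector
  obtain ⟨σ₀, hσ₀⟩ : ∃ σ, a σ ≠ 0 := by
    by_contra h
    push Not at h
    simp [h] at haunit
  have hbpos : 0 < ∑ σ, b σ ^ 2 := by
    have hb1 : b σ₀ = 1 := by simp only [hb, hasupp σ₀ hσ₀, if_true]
    calc (0 : ℝ) < b σ₀ ^ 2 := by rw [hb1]; norm_num
      _ ≤ ∑ σ, b σ ^ 2 := Finset.single_le_sum (fun σ _ => sq_nonneg (b σ)) (Finset.mem_univ σ₀)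
  have hE' : (xxzHamiltonian 1 G (-1) 1 : Op V 2).minEnergyOn (spinZSector (Λ := V) 1 M) = E := by
    rw [hEdef]; rfl
  rw [hE'] at hray
  -- `E Σb² ≤ 0 − D8 Σ b²` ⇒ `E + D8 ≤ 0`; and `E + D8 = ⟨a, A a⟩ ≥ 0`
  have hle : E + D8 ≤ 0 := by
    by_contra hpos
    push Not at hpos
    have := mul_pos hpos hbpos
    nlinarith
  have hge : 0 ≤ E + D8 := h1 ▸ inner_fmOp_nonneg G a
  have he0 : E + D8 = 0 := le_antisymm hle hge
  refine ⟨h1.trans he0, he0, ?_⟩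
  exact sectorFun_of_edgeSwapInvariant G hconn a
    (swapInvariant_of_inner_fmOp_eq_zero G a (h1.trans he0))

/-- **TEMPLE-FORM SECTOR GAP OF THE `Δ = 1` XXZ / HEISENBERG FERROMAGNET ON ANY CONNECTED GRAPH** (Caputo–Liggett–Richthammer
via the stirring projection): if `t` is a one-particle Poincaré constant of `G` (rate `½` per edge,
`t Σ‖g‖² ≤ ¼ Σ_x Σ_y [x ∼ y] ‖g x − g y‖²` for `Σ g = 0`), then for every sector `M`, every unit real sector amplitude `a` with
`H(1) a = E(M) a` and every unit real amplitude `φ` of the sector: `t (1 − ⟨a, φ⟩²) ≤ Re⟨φ, H(1) φ⟩ − E(M)`.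
[cite: CaputoLiggettRichthammer2010, Theorem 1.1 and §1.2] -/
theorem ferroSectorGap_graph (hconn : G.Connected) (hV : 2 ≤ Fintype.card V) {t : ℝ}
    (hRW : ∀ g : V → ℂ, ∑ x, g x = 0 →
      t * ∑ x, ‖g x‖ ^ 2 ≤ (1 / 4 : ℝ) * ∑ x, ∑ y, (if G.Adj x y then ‖g x - g y‖ ^ 2 else 0))
    (M : ℝ) (a φ : (V → Fin 2) → ℝ)
    (hasupp : ∀ σ, a σ ≠ 0 → zerosCard σ = (Fintype.card V : ℝ) / 2 + M) (haunit : ∑ σ, a σ ^ 2 = 1)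
    (haeig : (xxzHamiltonian 1 G (-1) 1 : Op V 2) *ᵥ (fun σ => (a σ : ℂ))
        = ((lowestEnergyInSector 1 (xxzHamiltonian 1 G (-1) 1) M : ℝ) : ℂ) • (fun σ => (a σ : ℂ)))
    (hφsupp : ∀ σ, φ σ ≠ 0 → zerosCard σ = (Fintype.card V : ℝ) / 2 + M) (hφunit : ∑ σ, φ σ ^ 2 = 1) :
    t * (1 - (∑ σ, a σ * φ σ) ^ 2)
      ≤ (star (fun σ => (φ σ : ℂ)) ⬝ᵥ (xxzHamiltonian 1 G (-1) 1 : Op V 2) *ᵥ (fun σ => (φ σ : ℂ))).re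
        - lowestEnergyInSector 1 (xxzHamiltonian 1 G (-1) 1) M := by
  classical
  set n : ℝ := (Fintype.card V : ℝ) / 2 + M with hn
  obtain ⟨_, hE, hconst⟩ := sectorGround_one_const G hconn M a hasupp haunit haeig
  -- the value of `a` on the sector
  obtain ⟨σ₀, hσ₀⟩ : ∃ σ, a σ ≠ 0 := by
    by_contra h
    push Not at h
    simp [h] at haunit
  set a₀ : ℝ := a σ₀ with ha₀
  have hσ₀n : zerosCard σ₀ = n := hasupp σ₀ hσ₀
  have haφ : ∀ σ, a σ * φ σ = a₀ * φ σ := by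
    intro σ
    by_cases hσ : zerosCard σ = n
    · rw [hconst σ σ₀ (hσ.trans hσ₀n.symm)]
    · have h1 : φ σ = 0 := by by_contra h'; exact hσ (hφsupp σ h')
      rw [h1, mul_zero, mul_zero]
  have haa : ∀ σ, a σ * a σ = a₀ * a σ := by
    intro σ
    by_cases hσ : zerosCard σ = n
    · rw [hconst σ σ₀ (hσ.trans hσ₀n.symm)]
    · have h1 : a σ = 0 := by by_contra h'; exact hσ (hasupp σ h')
      rw [h1, mul_zero, mul_zero]
  set c : ℝ := ∑ σ, a σ * φ σ with hc
  have hc' : c = a₀ * ∑ σ, φ σ := by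
    rw [hc, Finset.mul_sum]
    exact Finset.sum_congr rfl fun σ _ => haφ σ
  have hsuma : a₀ * ∑ σ, a σ = 1 := by
    rw [← haunit, Finset.mul_sum]
    refine Finset.sum_congr rfl fun σ _ => ?_
    rw [sq, haa σ]
  -- the mean-zero test amplitude
  set ψ : (V → Fin 2) → ℝ := fun σ => φ σ - c * a σ with hψ
  have hψsupp : ∀ σ, ψ σ ≠ 0 → zerosCard σ = n := by
    intro σ h
    by_contra hne
    have h1 : φ σ = 0 := by by_contra h'; exact hne (hφsupp σ h')
    have h2 : a σ = 0 := by by_contra h'; exact hne (hasupp σ h')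
    exact h (by simp only [hψ, h1, h2, mul_zero, sub_zero])
  have hψmean : ∑ σ, ψ σ = 0 := by
    simp only [hψ, Finset.sum_sub_distrib, ← Finset.mul_sum]
    rw [hc', mul_comm a₀, mul_assoc, hsuma, mul_one, sub_self]
  have hψnorm : ∑ σ, ψ σ ^ 2 = 1 - c ^ 2 := by
    have hexp : ∀ σ, ψ σ ^ 2 = φ σ ^ 2 - 2 * c * (a σ * φ σ) + c ^ 2 * a σ ^ 2 := by
      intro σ; simp only [hψ]; ring
    simp only [hexp, Finset.sum_add_distrib, Finset.sum_sub_distrib, ← Finset.mul_sum]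
    rw [hφunit, haunit, ← hc]
    ring
  have hdiff : ∀ (x y : V) (σ : V → Fin 2),
      ψ σ - ψ (σ ∘ ⇑(Equiv.swap x y)) = φ σ - φ (σ ∘ ⇑(Equiv.swap x y)) := by
    intro x y σ
    simp only [hψ]
    rw [hconst (σ ∘ ⇑(Equiv.swap x y)) σ (zerosCard_comp_perm σ _)]
    ring
  have hform : ∑ σ, ψ σ * fmOp G ψ σ = ∑ σ, φ σ * fmOp G φ σ := by
    rw [inner_fmOp_eq, inner_fmOp_eq]
    simp only [hdiff]
  -- the energy side
  have henergy : (star (fun σ => (φ σ : ℂ)) ⬝ᵥ (xxzHamiltonian 1 G (-1) 1 : Op V 2) *ᵥ (fun σ => (φ σ : ℂ))).re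
        - lowestEnergyInSector 1 (xxzHamiltonian 1 G (-1) 1) M
      = ∑ σ, φ σ * fmOp G φ σ := by
    rw [star_dotProduct_xxz_real, Complex.ofReal_re]
    have hq : ∑ σ, φ σ * (fmOp G φ σ + (1 - 1) * (isingW G σ * φ σ)) = ∑ σ, φ σ * fmOp G φ σ :=
      Finset.sum_congr rfl fun σ _ => by ring
    rw [hq, hφunit]
    linarith [hE]
  have key := exclusion_poincare_of_rw_gap G hV t hRW n ψ hψsupp hψmean
  rw [hψnorm, hform] at key
  rw [henergy]
  exact key

end General

end Summit.HubbardSuperconductivity.HubbardSuperconductivity.Theorems.AnisotropyChord.Transfer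

end
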